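import Literature.NumberTheory.EllipticCurves.ZpExtensionRank
import Literature.NumberTheory.EllipticCurves.ZpExtensionRankCFT
import Literature.NumberTheory.EllipticCurves.ZpExtensionRankAssemblyProofs
import Literature.NumberTheory.EllipticCurves.ZpExtensionDihedralProofs
import Literature.NumberTheory.Automorphic.AdicCompletionCompact
import HarnessLib

/-!
# `zpRank_eq_nrComplexPlaces_add_one` from class field theory (proofs only, no definitions)

Assembly of the named fact `Literature.ZpExtension.zpRank_eq_nrComplexPlaces_add_one K p`
(`ZpExtensionRank.lean`: for a number field of unit rank `0`, `Hom_cont(Γ_K, ℤ_p)` has a jointly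
surjective `ℤ_p`-basis of `r₂ + 1` characters — `Gal(K̃/K) ≃ ℤ_p^{r₂+1}`, Lang, *Cyclotomic Fields
I and II*, Ch. 5 §5, Thm. 5.2; Washington, Thm. 13.4) from the three named facts of
`ZpExtensionRankCFT.lean`, following Lang's proof (Ch. 5 §5, pp. 106–107):

1. `ZpExtension.inertia_le_kerSubgroup` (Washington Prop. 13.2: `ℤ_p`-extensions are unramified
   outside `p`) gives that every continuous `χ : Γ_K →ₜ* ℤ_p` factors through
   `Gal(M/K) = Γ_K ⧸ PRamified.kerSubgroup K p`, `M` the maximal abelian `p`-ramified extension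
   (`kerSubgroup_le_ker`: commutators die in the abelian target, a non-trivial `χ` is `pᵏ κ` for a
   `ℤ_p`-extension `κ` by saturation, `exists_surjective_of_ne_one`, and complex conjugations are
   involutions);
2. `PRamified.exists_closedEmbedding_localUnits` (Lang Thm. 5.1, class field theory) embeds
   `U_p/Ē` onto a finite-index subgroup of `Gal(M/K)`;
3. `PRamified.exists_openSubgroup_localUnits_equiv` (Lang p. 107: `U_p ⊇ W ≅ ℤ_p^{[K:ℚ]}` open of
   finite index) together with the finiteness of the units for unit rank `0`
   (`finite_units_of_rank_eq_zero`, Dirichlet; so `Ē` is finite and `W ∩ Ē = 1`) makes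
   `Hom_cont(U_p/Ē, ℤ_p)` free of rank `[K : ℚ]` (`exists_basis_localUnits_quot`, via the abstract
   count `RankAssembly.exists_surjective_basis` applied to `W ↪ U_p/Ē`);
4. the abstract count applied to `Γ_K ↠ Gal(M/K) ↩ U_p/Ē` gives a jointly surjective basis of
   `[K : ℚ] = r₂ + 1` characters (`finrank_eq_nrComplexPlaces_add_one`: unit rank `0` means one
   infinite place).

Main statement: `Literature.NumberTheory.EllipticCurves.ZpExtension.zpRank_eq_nrComplexPlaces_add_one_of_classFieldTheory`.
With it, `Literature.NumberTheory.EllipticCurves.zpRank_imaginaryQuadratic` (`Iwasawa.lean`) and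
`Literature.NumberTheory.EllipticCurves.ZpExtension.exists_isAnticyclotomic` (`ZpExtension.lean`) rest on exactly the three named facts
of `ZpExtensionRankCFT.lean` (`IwasawaZpRankProofs.lean`, `ZpExtensionAnticyclotomicProofs.lean`).

## References

* [Lang1990] S. Lang, *Cyclotomic Fields I and II*, GTM 121, Springer 1990, Ch. 5 §5, pp. 106–107,
  Thm. 5.1, Thm. 5.2 (held).
* [Washington1997] L. C. Washington, *Introduction to Cyclotomic Fields*, 2nd ed., GTM 83, Springer
  1997, §13.1, Prop. 13.2, Thm. 13.4 (not held).
-/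

noncomputable section

open scoped NumberField
open Field IsDedekindDomain NumberField NumberField.InfinitePlace Topology

universe u

namespace Literature.NumberTheory.EllipticCurves

namespace ZpExtension

open PRamified RankAssembly

variable {K : Type u} [Field K] [NumberField K] {p : ℕ} [Fact p.Prime]

/-! ### Unit rank zero -/

omit [Fact p.Prime] in
/-- A number field of unit rank `r₁ + r₂ - 1 = 0` has `[K : ℚ] = r₂ + 1` (it has exactly one
infinite place: `r₁ + r₂ = 1`, and `[K : ℚ] = r₁ + 2 r₂`). [folklore] -/
theorem finrank_eq_nrComplexPlaces_add_one (h0 : NumberField.Units.rank K = 0) :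
    Module.finrank ℚ K = nrComplexPlaces K + 1 := by
  have hpos : 0 < Fintype.card (InfinitePlace K) := Fintype.card_pos
  have h1 : Fintype.card (InfinitePlace K) = 1 := by
    rw [NumberField.Units.rank] at h0
    omega
  have h2 := card_eq_nrRealPlaces_add_nrComplexPlaces (K := K)
  have h3 := card_add_two_mul_card_eq_rank (K := K)
  omega

omit [Fact p.Prime] in
/-- A number field of unit rank `0` has finitely many units (Dirichlet: every unit is a root of
unity times a product over the empty fundamental system). [folklore] -/
theorem finite_units_of_rank_eq_zero (h0 : NumberField.Units.rank K = 0) : Finite (𝓞 K)ˣ := by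
  haveI : IsEmpty (Fin (NumberField.Units.rank K)) := by
    rw [h0]
    infer_instance
  have hsub : ∀ x : (𝓞 K)ˣ, x ∈ NumberField.Units.torsion K := fun x => by
    obtain ⟨⟨ζ, e⟩, hx, -⟩ := NumberField.Units.exist_unique_eq_mul_prod K x
    rw [Finset.univ_eq_empty, Finset.prod_empty, mul_one] at hx
    rw [hx]
    exact ζ.2
  exact Finite.of_injective (fun x => (⟨x, hsub x⟩ : NumberField.Units.torsion K))
    fun a b h => congrArg Subtype.val h

omit [Fact p.Prime] in
/-- For unit rank `0` the closure `Ē` of the global units in `U_p` is finite (a finite subgroup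
of a Hausdorff group is closed). [folklore] -/
theorem finite_closureUnits (h0 : NumberField.Units.rank K = 0) :
    (closureUnits K p : Set (LocalUnits K p)).Finite := by
  haveI := finite_units_of_rank_eq_zero h0
  have hfin : ((unitsToLocal K p).range : Set (LocalUnits K p)).Finite := by
    rw [MonoidHom.coe_range]
    exact Set.finite_range _
  have hcl : IsClosed (((unitsToLocal K p).range : Set (LocalUnits K p))) := hfin.isClosed
  rw [closureUnits, Subgroup.topologicalClosure_coe, hcl.closure_eq]
  exact hfin

/-! ### Continuous characters of `ℤ_pⁿ` -/

/-- A continuous additive map `h : ℤ_pⁿ → ℤ_p` is `ℤ_p`-linear: `h x = ∑ xᵢ h(eᵢ)` (density of `ℕ`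
in `ℤ_p`). [folklore] -/
theorem apply_eq_sum_mul_of_continuous {n : ℕ} (h : (Fin n → ℤ_[p]) →+ ℤ_[p])
    (hc : Continuous h) (x : Fin n → ℤ_[p]) :
    h x = ∑ i, x i * h (Pi.single i 1) := by
  classical
  -- one coordinate at a time
  have hsingle : ∀ i (t : ℤ_[p]), h (Pi.single i t) = t * h (Pi.single i 1) := by
    intro i t
    have hcont_single : Continuous fun t : ℤ_[p] => (Pi.single i t : Fin n → ℤ_[p]) :=
      continuous_pi fun j => by
        rcases eq_or_ne j i with rfl | hj
        · simp only [Pi.single_eq_same]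
          exact continuous_id
        · simp only [Pi.single_eq_of_ne hj]
          exact continuous_const
    have hcl : IsClosed {t : ℤ_[p] | h (Pi.single i t) = t * h (Pi.single i 1)} :=
      isClosed_eq (hc.comp hcont_single) (continuous_id.mul continuous_const)
    refine PadicInt.denseRange_natCast.induction_on t hcl fun k => ?_
    change h (Pi.single i (k : ℤ_[p])) = (k : ℤ_[p]) * h (Pi.single i 1)
    induction k with
    | zero => simp
    | succ k ih =>
      rw [Nat.cast_succ, Pi.single_add, map_add, ih, add_mul, one_mul]
  conv_lhs => rw [← Finset.univ_sum_single x]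
  rw [map_sum]
  exact Finset.sum_congr rfl fun i _ => hsingle i (x i)

/-! ### A `ℤ_p`-basis of `Hom_cont(U_p/Ē, ℤ_p)` for unit rank zero -/

set_option maxHeartbeats 800000 in
-- The final `RankAssembly.exists_surjective_basis` application unifies large instance terms on
-- `LocalUnits K p ⧸ closureUnits K p` (a quotient of a product of unit groups of completions); the
-- defeq check measured about twice the default heartbeat budget, hence the raised limit.
/-- For unit rank `0`, given an open subgroup `W ≅ ℤ_p^{[K:ℚ]}` of finite index in `U_p`
(`exists_openSubgroup_localUnits_equiv`), `Hom_cont(U_p/Ē, ℤ_p)` has a `ℤ_p`-basis of `[K : ℚ]`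
characters: `Ē` is finite, so `W ∩ Ē = 1` and `W ↪ U_p/Ē` is a topological embedding of finite
index, and `exists_surjective_basis` applies with the coordinate characters of `W ≅ ℤ_p^{[K:ℚ]}`.
(Lang, *Cyclotomic Fields I and II*, Ch. 5 §5, p. 107: `G_p^{ab}(K) ∼ ℤ_p^{[K:ℚ]-r_p}`, here
`r_p = 0`.) [folklore] -/
theorem exists_basis_localUnits_quot (h0 : NumberField.Units.rank K = 0)
    (h3 : exists_openSubgroup_localUnits_equiv K p) :
    ∃ Ψ : Fin (Module.finrank ℚ K) →
        (LocalUnits K p ⧸ closureUnits K p →ₜ* Multiplicative ℤ_[p]),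
      (∀ ψ : LocalUnits K p ⧸ closureUnits K p →ₜ* Multiplicative ℤ_[p],
        ∃ a : Fin (Module.finrank ℚ K) → ℤ_[p], ∀ v, (ψ v).toAdd = ∑ i, a i * (Ψ i v).toAdd) ∧
      (∀ a : Fin (Module.finrank ℚ K) → ℤ_[p],
        (∀ v, ∑ i, a i * (Ψ i v).toAdd = 0) → a = 0) := by
  classical
  obtain ⟨W, hWo, hWi, ⟨e⟩⟩ := h3
  set n := Module.finrank ℚ K with hn
  -- topological preliminaries on `U_p/Ē` (separation first, with few local instances around)
  haveI : IsClosed ((closureUnits K p : Subgroup (LocalUnits K p)) : Set (LocalUnits K p)) :=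
    Subgroup.isClosed_topologicalClosure _
  haveI : T3Space (LocalUnits K p ⧸ closureUnits K p) :=
    QuotientGroup.instT3Space (closureUnits K p)
  haveI htV : T2Space (LocalUnits K p ⧸ closureUnits K p) :=
    @T25Space.t2Space _ _ T3Space.t25Space
  haveI hgV : IsTopologicalGroup (LocalUnits K p ⧸ closureUnits K p) :=
    QuotientGroup.instIsTopologicalGroup (closureUnits K p)
  haveI : ∀ v : placesAbove K p, CompactSpace (v.1.adicCompletionIntegers K) := fun v =>
    Literature.NumberTheory.Automorphic.compactSpace_adicCompletionIntegers' K v.1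
  haveI hcU : CompactSpace (LocalUnits K p) := Pi.compactSpace
  haveI hcV : CompactSpace (LocalUnits K p ⧸ closureUnits K p) := Quotient.compactSpace
  haveI : IsMulCommutative (LocalUnits K p ⧸ closureUnits K p) := ⟨⟨fun a b => mul_comm a b⟩⟩
  haveI hWc : CompactSpace W :=
    isCompact_iff_compactSpace.mp (Subgroup.isClosed_of_isOpen W hWo).isCompact
  have hfinE := finite_closureUnits (p := p) h0
  -- the embedding `W → U_p/Ē`
  let f : W →ₜ* (LocalUnits K p ⧸ closureUnits K p) :=
    ⟨(QuotientGroup.mk' (closureUnits K p)).comp W.subtype,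
      continuous_quot_mk.comp continuous_subtype_val⟩
  have hf_apply : ∀ w : W, f w = ((w : LocalUnits K p) : LocalUnits K p ⧸ closureUnits K p) :=
    fun w => rfl
  -- `W ∩ Ē = 1`: `W ≅ ℤ_pⁿ` is torsion-free and `Ē` is finite
  have hinj : Function.Injective f := by
    rw [injective_iff_map_eq_one]
    intro w hw
    rw [hf_apply, QuotientGroup.eq_one_iff] at hw
    have hfo : IsOfFinOrder (⟨(w : LocalUnits K p), hw⟩ : closureUnits K p) := by
      haveI : Finite (closureUnits K p) := hfinE.to_subtype
      exact isOfFinOrder_of_finite _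
    obtain ⟨k, hk, hk1⟩ := hfo.exists_pow_eq_one
    have hwk : w ^ k = 1 := by
      apply Subtype.ext
      simpa using congrArg Subtype.val hk1
    have hek : k • (e w).toAdd = 0 := by
      rw [← toAdd_pow, ← map_pow, hwk, map_one, toAdd_one]
    have he0 : (e w).toAdd = 0 := (smul_eq_zero_iff_right hk.ne').mp hek
    apply e.injective
    rw [map_one]
    exact Multiplicative.toAdd.injective (he0.trans toAdd_one.symm)
  have hf : IsEmbedding f := ((map_continuous f).isClosedEmbedding hinj).isEmbedding
  have hfi : f.toMonoidHom.range.FiniteIndex := by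
    have hrange : f.toMonoidHom.range = W.map (QuotientGroup.mk' (closureUnits K p)) := by
      change ((QuotientGroup.mk' (closureUnits K p)).comp W.subtype).range = _
      rw [MonoidHom.range_comp, Subgroup.range_subtype]
    refine ⟨fun h => ?_⟩
    rw [hrange] at h
    have hd := Subgroup.index_map_dvd W (QuotientGroup.mk'_surjective (closureUnits K p))
    rw [h, zero_dvd_iff] at hd
    exact hWi.index_ne_zero hd
  -- coordinate characters of `W ≅ ℤ_pⁿ`
  let ev : Fin n → (Multiplicative (Fin n → ℤ_[p]) →ₜ* Multiplicative ℤ_[p]) := fun i =>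
    { toFun := fun x => Multiplicative.ofAdd (x.toAdd i)
      map_one' := rfl
      map_mul' := fun _ _ => rfl
      continuous_toFun := continuous_ofAdd.comp ((continuous_apply i).comp continuous_toAdd) }
  let eh : W →ₜ* Multiplicative (Fin n → ℤ_[p]) := ⟨e.toMulEquiv.toMonoidHom, e.continuous⟩
  have heh : ∀ w, eh w = e w := fun w => rfl
  let Ψ₀ : Fin n → (W →ₜ* Multiplicative ℤ_[p]) := fun i => (ev i).comp eh
  have hΨ₀ : ∀ i w, (Ψ₀ i w).toAdd = (e w).toAdd i := fun i w => rfl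
  have hΨ₀span : ∀ ψ : W →ₜ* Multiplicative ℤ_[p], ∃ a : Fin n → ℤ_[p],
      ∀ w, (ψ w).toAdd = ∑ i, a i * (Ψ₀ i w).toAdd := by
    intro ψ
    let h : (Fin n → ℤ_[p]) →+ ℤ_[p] :=
      { toFun := fun x => (ψ (e.symm (Multiplicative.ofAdd x))).toAdd
        map_zero' := by rw [ofAdd_zero, map_one, map_one, toAdd_one]
        map_add' := fun x y => by rw [ofAdd_add, map_mul, map_mul, toAdd_mul] }
    have hc : Continuous h :=
      continuous_toAdd.comp ((map_continuous ψ).comp (e.symm.continuous.comp continuous_ofAdd))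
    refine ⟨fun i => h (Pi.single i 1), fun w => ?_⟩
    have hw : (ψ w).toAdd = h ((e w).toAdd) := by
      change _ = (ψ (e.symm (Multiplicative.ofAdd (e w).toAdd))).toAdd
      rw [ofAdd_toAdd, ContinuousMulEquiv.symm_apply_apply]
    rw [hw, apply_eq_sum_mul_of_continuous h hc]
    exact Finset.sum_congr rfl fun i _ => mul_comm _ _
  have hΨ₀indep : ∀ a : Fin n → ℤ_[p], (∀ w, ∑ i, a i * (Ψ₀ i w).toAdd = 0) → a = 0 := by
    intro a ha
    funext j
    have h := ha (e.symm (Multiplicative.ofAdd (Pi.single j 1)))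
    simp_rw [hΨ₀, ContinuousMulEquiv.apply_symm_apply, toAdd_ofAdd] at h
    rw [Finset.sum_eq_single j (fun i _ hij => by rw [Pi.single_eq_of_ne hij, mul_zero])
      (fun hj => absurd (Finset.mem_univ j) hj), Pi.single_eq_same, mul_one] at h
    exact h
  -- assemble with `π = id`
  obtain ⟨Ψ, -, hΨspan, hΨindep⟩ :=
    exists_surjective_basis (p := p) (Γ := LocalUnits K p ⧸ closureUnits K p)
      (G := LocalUnits K p ⧸ closureUnits K p) (V := W)
      (ContinuousMonoidHom.id _) Function.surjective_id
      (fun χ σ hσ => by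
        change σ = 1 at hσ
        rw [hσ, map_one])
      f hf hfi Ψ₀ hΨ₀span hΨ₀indep
  exact ⟨Ψ, hΨspan, hΨindep⟩

/-! ### Assembly -/

/-- **Every continuous `ℤ_p`-valued character of `Γ_K` factors through `Gal(M/K)`**, `M` the
maximal abelian `p`-ramified extension (given Washington Prop. 13.2,
`ZpExtension.inertia_le_kerSubgroup`): the target is abelian (commutators die), a non-trivial
character is `pᵏ κ` for a `ℤ_p`-extension `κ` (saturation), which kills the inertia groups outside
`p`, and complex conjugations are involutions, hence die in the torsion-free `ℤ_p`. [folklore] -/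
theorem kerSubgroup_le_ker (h1 : inertia_le_kerSubgroup K p)
    (χ : absoluteGaloisGroup K →ₜ* Multiplicative ℤ_[p]) :
    PRamified.kerSubgroup K p ≤ χ.toMonoidHom.ker := by
  refine Subgroup.topologicalClosure_minimal _ (Subgroup.normalClosure_le_normal ?_) ?_
  · rintro τ ((hτ | hτ) | hτ)
    · exact Abelianization.commutator_subset_ker χ.toMonoidHom hτ
    · simp only [Set.mem_iUnion] at hτ
      obtain ⟨v, hv, 𝔓, h𝔓, hτ⟩ := hτ
      rw [SetLike.mem_coe, MonoidHom.mem_ker]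
      by_cases hχ : χ = 1
      · rw [hχ]
        rfl
      · obtain ⟨g', k, hg's, hg'⟩ := exists_surjective_of_ne_one χ hχ
        have hmem : τ ∈ (⟨g', hg's⟩ : ZpExtension K p).kerSubgroup := h1 ⟨g', hg's⟩ hv h𝔓 hτ
        rw [mem_kerSubgroup] at hmem
        change g' τ = 1 at hmem
        change χ τ = 1
        apply Multiplicative.toAdd.injective
        rw [hg' τ, toAdd_one, hmem, toAdd_one, mul_zero]
    · obtain ⟨φ, hc⟩ := hτ
      rw [SetLike.mem_coe, MonoidHom.mem_ker]
      change χ τ = 1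
      have h2 : (χ τ) ^ 2 = 1 := by rw [← map_pow, hc.sq_eq_one, map_one]
      have h2' := congrArg Multiplicative.toAdd h2
      rw [toAdd_pow, toAdd_one, smul_eq_zero_iff_right two_ne_zero] at h2'
      exact Multiplicative.toAdd.injective (h2'.trans toAdd_one.symm)
  · change IsClosed (χ ⁻¹' {1})
    exact (isClosed_singleton (x := (1 : Multiplicative ℤ_[p]))).preimage (map_continuous χ)

/-- **The `ℤ_p`-rank of a number field of unit rank zero, from class field theory.**  Assume
(1) `ℤ_p`-extensions are unramified outside `p` (Washington Prop. 13.2,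
`ZpExtension.inertia_le_kerSubgroup`), (2) the Artin map embeds `U_p/Ē` onto a finite-index
subgroup of `Gal(M/K)`, `M` the maximal abelian `p`-ramified extension (Lang, Ch. 5 §5, Thm. 5.1,
`PRamified.exists_closedEmbedding_localUnits`), and (3) `U_p` has an open finite-index subgroup
`≅ ℤ_p^{[K:ℚ]}` (Lang, Ch. 5 §5, p. 107, `PRamified.exists_openSubgroup_localUnits_equiv`).  Then a
number field `K` of unit rank `0` satisfies `Literature.NumberTheory.EllipticCurves.ZpExtension.zpRank_eq_nrComplexPlaces_add_one`:
`Hom_cont(Γ_K, ℤ_p)` has a jointly surjective `ℤ_p`-basis of `r₂ + 1` characters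
(`Gal(K̃/K) ≃ ℤ_p^{r₂+1}`).  This is Lang's proof of Thm. 5.2 (*Cyclotomic Fields I and II*, Ch. 5
§5): `Gal(M/K) ∼ U_p/Ē ∼ ℤ_p^{[K:ℚ]-r_p}` with `r_p = 0` (the unit group is finite) and
`[K : ℚ] = r₂ + 1`; the rank count is `RankAssembly.exists_surjective_basis`.
[cite: Lang1990, Ch. 5 §5, Thm. 5.2] [cite: Washington1997, Thm. 13.4] -/
theorem zpRank_eq_nrComplexPlaces_add_one_of_classFieldTheory
    (h1 : inertia_le_kerSubgroup K p) (h2 : exists_closedEmbedding_localUnits K p)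
    (h3 : exists_openSubgroup_localUnits_equiv K p) :
    zpRank_eq_nrComplexPlaces_add_one K p := by
  intro h0
  classical
  obtain ⟨Ψ, hΨspan, hΨindep⟩ := exists_basis_localUnits_quot h0 h3
  obtain ⟨f, hf, hfi⟩ := h2
  haveI : IsClosed ((closureUnits K p : Subgroup (LocalUnits K p)) : Set (LocalUnits K p)) :=
    Subgroup.isClosed_topologicalClosure _
  have hfac : ∀ (χ : absoluteGaloisGroup K →ₜ* Multiplicative ℤ_[p]) σ,
      PRamified.restrict K p σ = 1 → χ σ = 1 := by
    intro χ σ hσ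
    rw [PRamified.restrict_apply, QuotientGroup.eq_one_iff] at hσ
    exact kerSubgroup_le_ker h1 χ hσ
  obtain ⟨Φ, hsurj, hspan, -⟩ := exists_surjective_basis (PRamified.restrict K p)
    (restrict_surjective K p) hfac f hf.isEmbedding hfi Ψ hΨspan hΨindep
  -- reindex `Fin [K:ℚ] ≃ Fin (r₂ + 1)`
  let ε : Fin (nrComplexPlaces K + 1) ≃ Fin (Module.finrank ℚ K) :=
    finCongr (finrank_eq_nrComplexPlaces_add_one h0).symm
  refine ⟨fun i => Φ (ε i), fun y => ?_, fun χ => ?_⟩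
  · obtain ⟨σ, hσ⟩ := hsurj (fun j => y (ε.symm j))
    refine ⟨σ, funext fun i => ?_⟩
    have h := congrFun hσ (ε i)
    rwa [Equiv.symm_apply_apply] at h
  · obtain ⟨a, ha⟩ := hspan χ
    refine ⟨fun i => a (ε i), fun σ => ?_⟩
    rw [ha σ]
    exact (Equiv.sum_comp ε (fun j => a j * (Φ j σ).toAdd)).symm

end ZpExtension

end Literature.NumberTheory.EllipticCurves
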